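import Summits.AtomisticToContinuum.HydrodynamicLimit.Theorems.BoltzmannGreenKubo.Negative.JointMeasurability
import Summits.AtomisticToContinuum.HydrodynamicLimit.Theorems.AntiMazurCoboundariesDefectSplit

/-!
# The bad set of `InfluenceLocality` is measurable; the error-corrector pressure bound

Route `AntiMazurCoboundaries` of `AtomisticToContinuum/HydrodynamicLimit`, support item
stmt-AtomisticToContinuum-13917 (`LocalCertificateTransfer`), plan step (3) (and refuter g47-2's point (5):
the integrand of `InfluenceLocality` must be shown (null-)measurable before its bound can be combined with
anything by Hölder / Cauchy–Schwarz / invariance). Helper lemmas (`--supports`):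

* `ForecastError.localClusterState_tendsto_right` — the range-`R` local forecast of a particle is
  right-continuous in time along sequences (it is a good orbit of a cluster flow, or frozen).
* `ForecastError.bad_iff_countable` — for a GOOD initial datum, "particle `i` is bad on `[0, H]`"
  (`∃ t ∈ [0, H]`, true state `≠` forecast — verbatim the event of the crux `InfluenceLocality`) can be
  tested on the countable set `([0, H] ∩ ℚ) ∪ {H}` (right-continuity of both orbits, uniqueness of limits).
* `ForecastError.measurableSet_good_inter_bad` — hence `good ∩ {i bad}` is measurable.
* `ForecastError.aemeasurable_badCount`, `ForecastError.aemeasurable_exp_badCount` — under any law that does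
  not charge the bad data (e.g. `G_N ≪` Liouville) the number of bad particles, and the integrand
  `exp(lam · #bad)` of `InfluenceLocality`, are a.e.-measurable.
* `ForecastError.lintegral_exp_errorQuotient_le` — THE ERROR-CORRECTOR PRESSURE BOUND (plan step (3)
  complete, modulo the crux): under a law preserved by the flow and carried by the good set, for the error
  corrector `E = W_{R,H} − W^{true}_H` and an amplitude `a ≥ 0`,
  `∫ exp(a |s⁻¹(E(Φ_s z) − E(z))|) dμ ≤ ∫ exp((2aHC/s) · #bad(z)) dμ`
  (pointwise bound `abs_errorQuotient_le`, Cauchy–Schwarz, invariance) — the right side is exactly what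
  `InfluenceLocality` controls, with `lam = 2aHC/s`.

References: route docstring of stmt-AtomisticToContinuum-13917, step (3); folklore.
-/

noncomputable section

open MeasureTheory Set Filter Topology

namespace Summit.AtomisticToContinuum.HydrodynamicLimit.Theorems

open Literature.Analysis.FluidPDE
open Literature.MathematicalPhysics.KineticTheory (T3)

namespace ForecastError

variable {N : ℕ} {ε : ℝ}

/-- **Right-continuity of local forecasts**: along any sequence of times decreasing to `t`, the range-`R`
local cluster state of particle `i` converges to its value at `t` (a good orbit of the cluster flow is
right-continuous, `flow_tendsto_right`; off the good set the cluster is frozen). [folklore] -/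
theorem localClusterState_tendsto_right (Ψ : (k : ℕ) → HardSphereFlow (Torus.geometry (Fin 3)) ε k)
    (R : ℝ) (z : Config N (Fin 3) T3) (i : Fin N) (t : ℝ) {u : ℕ → ℝ} (hu : ∀ k, t ≤ u k)
    (hut : Tendsto u atTop (𝓝 t)) :
    Tendsto (fun k => localClusterState Ψ R (u k) z i) atTop (𝓝 (localClusterState Ψ R t z i)) := by
  -- the statement for an arbitrary cluster `S` and label `m`
  have key : ∀ (S : Finset (Fin N)) (m : Fin S.card),
      Tendsto (fun k => clusterStateIn Ψ S m (u k) z) atTop (𝓝 (clusterStateIn Ψ S m t z)) := by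
    intro S m
    by_cases hw : Config.restrictTo S z ∈ (Ψ S.card).good
    · have h1 : ∀ τ, clusterStateIn Ψ S m τ z = (Ψ S.card).flow τ (Config.restrictTo S z) m := fun τ =>
        clusterStateIn_of_mem_good Ψ m τ hw
      simp only [h1]
      exact ((continuous_apply m).tendsto _).comp
        (BoltzmannGreenKuboOrthMomentum.flow_tendsto_right (Ψ S.card) hw t hu hut)
    · have h1 : ∀ τ, clusterStateIn Ψ S m τ z = z (S.orderEmbOfFin rfl m) := fun τ =>
        clusterStateIn_of_not_mem_good Ψ m τ hw
      simp only [h1]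
      exact tendsto_const_nhds
  exact key _ _

/-- **Countable reduction of badness.** For a good initial datum `z`, particle `i` is bad on `[0, H]`
(`∃ t ∈ [0, H]` with true state `≠` range-`R` forecast) iff this already happens at a time of the
countable set `([0, H] ∩ ℚ) ∪ {H}`: if the two right-continuous orbits agreed at all rational times of
`(t₀, H)` they would agree at `t₀` (uniqueness of limits). [folklore] -/
theorem bad_iff_countable (Φ : HardSphereFlow (Torus.geometry (Fin 3)) ε N)
    (Ψ : (k : ℕ) → HardSphereFlow (Torus.geometry (Fin 3)) ε k) (R : ℝ) {H : ℝ} (hH : 0 ≤ H)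
    {z : Config N (Fin 3) T3} (hz : z ∈ Φ.good) (i : Fin N) :
    (∃ t ∈ Icc (0 : ℝ) H, Φ.flow t z i ≠ localClusterState Ψ R t z i) ↔
      ∃ t ∈ (Icc (0 : ℝ) H ∩ range ((↑) : ℚ → ℝ)) ∪ {H},
        Φ.flow t z i ≠ localClusterState Ψ R t z i := by
  constructor
  · rintro ⟨t₀, ht₀, hne⟩
    by_cases hH' : t₀ = H
    · exact ⟨H, Or.inr rfl, hH' ▸ hne⟩
    have hlt : t₀ < H := lt_of_le_of_ne ht₀.2 hH'
    by_contra hall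
    push Not at hall
    -- rational times decreasing to `t₀` inside `(t₀, H)`
    have hq : ∀ k : ℕ, ∃ q : ℚ, t₀ < q ∧ (q : ℝ) < min H (t₀ + 1 / ((k : ℝ) + 1)) := fun k =>
      exists_rat_btwn (lt_min hlt (by linarith [Nat.one_div_pos_of_nat (α := ℝ) (n := k)]))
    choose q hq using hq
    have hu : ∀ k, t₀ ≤ (q k : ℝ) := fun k => (hq k).1.le
    have hut : Tendsto (fun k => (q k : ℝ)) atTop (𝓝 t₀) := by
      have hup : Tendsto (fun k : ℕ => t₀ + 1 / ((k : ℝ) + 1)) atTop (𝓝 t₀) := by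
        have := tendsto_const_nhds (x := t₀) (f := (atTop : Filter ℕ)) |>.add
          tendsto_one_div_add_atTop_nhds_zero_nat
        rwa [add_zero] at this
      exact tendsto_of_tendsto_of_tendsto_of_le_of_le tendsto_const_nhds hup hu
        fun k => ((hq k).2.le.trans (min_le_right _ _))
    have h1 : Tendsto (fun k => Φ.flow (q k) z i) atTop (𝓝 (Φ.flow t₀ z i)) :=
      ((continuous_apply i).tendsto _).comp
        (BoltzmannGreenKuboOrthMomentum.flow_tendsto_right Φ hz t₀ hu hut)
    have h2 := localClusterState_tendsto_right Ψ R z i t₀ hu hut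
    have heq : (fun k => Φ.flow (q k) z i) = fun k => localClusterState Ψ R (q k) z i := by
      funext k
      exact hall _ (Or.inl ⟨⟨ht₀.1.trans (hu k), (hq k).2.le.trans (min_le_left _ _)⟩,
        mem_range_self _⟩)
    rw [heq] at h1
    exact hne (tendsto_nhds_unique h1 h2)
  · rintro ⟨t, ht, hne⟩
    refine ⟨t, ?_, hne⟩
    rcases ht with ⟨ht, _⟩ | ht
    · exact ht
    · rw [mem_singleton_iff] at ht
      rw [ht]
      exact ⟨hH, le_rfl⟩

/-- At a FIXED time, `{z | (Φ_t z)_i ≠ ζ^{(i,R)}_t(z)}` is measurable (preimage of the off-diagonal under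
two measurable maps into the Hausdorff second-countable space `𝕋³ × ℝ³`). [folklore] -/
theorem measurableSet_ne_forecast_at (Φ : HardSphereFlow (Torus.geometry (Fin 3)) ε N)
    (Ψ : (k : ℕ) → HardSphereFlow (Torus.geometry (Fin 3)) ε k) (R t : ℝ) (i : Fin N) :
    MeasurableSet {z : Config N (Fin 3) T3 | Φ.flow t z i ≠ localClusterState Ψ R t z i} := by
  have hf : Measurable fun z : Config N (Fin 3) T3 => Φ.flow t z i :=
    (measurable_pi_apply i).comp (Φ.measurable_flow t)
  have hg : Measurable fun z : Config N (Fin 3) T3 => localClusterState Ψ R t z i := by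
    have h : Measurable (Function.uncurry fun (τ : ℝ) (z : Config N (Fin 3) T3) =>
        localClusterState Ψ R τ z i) :=
      measurable_localClusterState Ψ Torus.continuous_geometry_translate Torus.measurable_geometry_sepVec R i
    exact h.of_uncurry_left
  have hrepr : {z : Config N (Fin 3) T3 | Φ.flow t z i ≠ localClusterState Ψ R t z i} =
      (fun z => (Φ.flow t z i, localClusterState Ψ R t z i)) ⁻¹' (Set.diagonal (T3 × EuclideanSpace ℝ (Fin 3)))ᶜ := by
    ext z
    simp only [mem_setOf_eq, mem_preimage, mem_compl_iff, mem_diagonal_iff]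
  rw [hrepr]
  exact (hf.prodMk hg) isClosed_diagonal.measurableSet.compl

/-- **Measurability of the bad set on the good set**: `{z ∈ good | ∃ t ∈ [0, H], (Φ_t z)_i ≠ ζ^{(i,R)}_t(z)}`
is measurable (countable reduction `bad_iff_countable`; at a fixed time `measurableSet_ne_forecast_at`).
[folklore] -/
theorem measurableSet_good_inter_bad (Φ : HardSphereFlow (Torus.geometry (Fin 3)) ε N)
    (Ψ : (k : ℕ) → HardSphereFlow (Torus.geometry (Fin 3)) ε k) (R : ℝ) {H : ℝ} (hH : 0 ≤ H)
    (i : Fin N) :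
    MeasurableSet {z : Config N (Fin 3) T3 | z ∈ Φ.good ∧
      ∃ t ∈ Icc (0 : ℝ) H, Φ.flow t z i ≠ localClusterState Ψ R t z i} := by
  have hD : ((Icc (0 : ℝ) H ∩ range ((↑) : ℚ → ℝ)) ∪ {H}).Countable :=
    ((countable_range _).mono inter_subset_right).union (countable_singleton H)
  have hrepr : {z : Config N (Fin 3) T3 | z ∈ Φ.good ∧
      ∃ t ∈ Icc (0 : ℝ) H, Φ.flow t z i ≠ localClusterState Ψ R t z i} =
      Φ.good ∩ ⋃ t ∈ (Icc (0 : ℝ) H ∩ range ((↑) : ℚ → ℝ)) ∪ {H},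
        {z | Φ.flow t z i ≠ localClusterState Ψ R t z i} := by
    ext z
    rw [mem_setOf_eq, mem_inter_iff, mem_iUnion₂]
    constructor
    · rintro ⟨hz, h⟩
      obtain ⟨t, ht, hne⟩ := (bad_iff_countable Φ Ψ R hH hz i).1 h
      exact ⟨hz, t, ht, hne⟩
    · rintro ⟨hz, t, ht, hne⟩
      exact ⟨hz, (bad_iff_countable Φ Ψ R hH hz i).2 ⟨t, ht, hne⟩⟩
  rw [hrepr]
  exact Φ.measurableSet_good.inter
    (MeasurableSet.biUnion hD fun t _ => measurableSet_ne_forecast_at Φ Ψ R t i)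

open scoped Classical in
/-- **The bad count is a.e.-measurable** under any law that does not charge the bad data: the number of
particles whose true state differs from their range-`R` forecast at some time of `[0, H]` (verbatim the
`Finset.card` of the crux `InfluenceLocality`, up to the scaling of `H` and `R`) agrees on the good set with
a sum of indicators of measurable sets. [folklore] -/
theorem aemeasurable_badCount (Φ : HardSphereFlow (Torus.geometry (Fin 3)) ε N)
    (Ψ : (k : ℕ) → HardSphereFlow (Torus.geometry (Fin 3)) ε k) (R : ℝ) {H : ℝ} (hH : 0 ≤ H)
    (μ : Measure (Config N (Fin 3) T3)) (hgood : μ Φ.goodᶜ = 0) :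
    AEMeasurable (fun z : Config N (Fin 3) T3 => ((Finset.univ.filter fun i : Fin N =>
      ∃ t ∈ Icc (0 : ℝ) H, Φ.flow t z i ≠ localClusterState Ψ R t z i).card : ℝ)) μ := by
  classical
  set A : Fin N → Set (Config N (Fin 3) T3) := fun i => {z | z ∈ Φ.good ∧
    ∃ t ∈ Icc (0 : ℝ) H, Φ.flow t z i ≠ localClusterState Ψ R t z i} with hAdef
  have hA : ∀ i, MeasurableSet (A i) := fun i => measurableSet_good_inter_bad Φ Ψ R hH i
  set g : Config N (Fin 3) T3 → ℝ := fun z => ∑ i, (A i).indicator (fun _ => (1 : ℝ)) z with hgdef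
  have hg : Measurable g := Finset.measurable_sum _ fun i _ => measurable_const.indicator (hA i)
  have hae : ∀ᵐ z ∂μ, z ∈ Φ.good := mem_ae_iff.2 hgood
  refine ⟨g, hg, ?_⟩
  filter_upwards [hae] with z hz
  rw [Finset.card_filter]
  push_cast
  refine Finset.sum_congr rfl fun i _ => ?_
  by_cases hb : ∃ t ∈ Icc (0 : ℝ) H, Φ.flow t z i ≠ localClusterState Ψ R t z i
  · have hzA : z ∈ A i := ⟨hz, hb⟩
    rw [indicator_of_mem hzA, if_pos hb]
  · have hzA : z ∉ A i := fun h => hb h.2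
    rw [indicator_of_notMem hzA, if_neg hb]

open scoped Classical in
/-- **The integrand of `InfluenceLocality` is a.e.-measurable** under any law not charging the bad data:
`z ↦ exp(lam · #bad(z))` (as an `ℝ≥0∞`-valued function via `ENNReal.ofReal`). [folklore] -/
theorem aemeasurable_exp_badCount (Φ : HardSphereFlow (Torus.geometry (Fin 3)) ε N)
    (Ψ : (k : ℕ) → HardSphereFlow (Torus.geometry (Fin 3)) ε k) (R : ℝ) {H : ℝ} (hH : 0 ≤ H)
    (μ : Measure (Config N (Fin 3) T3)) (hgood : μ Φ.goodᶜ = 0) (lam : ℝ) :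
    AEMeasurable (fun z : Config N (Fin 3) T3 => ENNReal.ofReal (Real.exp (lam *
      ((Finset.univ.filter fun i : Fin N =>
        ∃ t ∈ Icc (0 : ℝ) H, Φ.flow t z i ≠ localClusterState Ψ R t z i).card : ℝ)))) μ :=
  (Real.measurable_exp.comp_aemeasurable
    ((aemeasurable_badCount Φ Ψ R hH μ hgood).const_mul lam)).ennreal_ofReal

/-! ## The error-corrector pressure bound (plan step (3)) -/

open scoped Classical in
/-- **The error-corrector pressure is controlled by the bad-count pressure.** Let `μ` be preserved by
every `Φ_t` and carried by the good set, `f` a one-body observable with `|f| ≤ C`, `0 ≤ H`, `0 < s`,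
`0 ≤ a`, and `E = W_{R,H} − W^{true}_H` the error corrector. Then
`∫ exp(a · |s⁻¹ (E(Φ_s z) − E(z))|) dμ ≤ ∫ exp((2aHC/s) · #bad(z)) dμ`, where `#bad(z)` counts the
particles whose true state differs from their range-`R` forecast at some time of `[0, H]` (pointwise
`abs_errorQuotient_le`; Cauchy–Schwarz; the factor at `Φ_s z` has the same law by invariance). [folklore] -/
theorem lintegral_exp_errorQuotient_le (Φ : HardSphereFlow (Torus.geometry (Fin 3)) ε N)
    (Ψ : (k : ℕ) → HardSphereFlow (Torus.geometry (Fin 3)) ε k) (R : ℝ) {H : ℝ} (hH : 0 ≤ H)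
    {f : T3 × EuclideanSpace ℝ (Fin 3) → ℝ} {C : ℝ} (hf : ∀ q, |f q| ≤ C) {s : ℝ} (hs : 0 < s)
    (E : Config N (Fin 3) T3 → ℝ)
    (hE : ∀ x, E x = localForecastCorrector Ψ R H f x -
      (-∑ i, ∫ t in (0 : ℝ)..H, (1 - t / H) * f (Φ.flow t x i)))
    (μ : Measure (Config N (Fin 3) T3)) (hinv : ∀ t, MeasurePreserving (Φ.flow t) μ μ)
    (hgood : μ Φ.goodᶜ = 0) {a : ℝ} (ha : 0 ≤ a) :
    ∫⁻ z, ENNReal.ofReal (Real.exp (a * |s⁻¹ * (E (Φ.flow s z) - E z)|)) ∂μ ≤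
      ∫⁻ z, ENNReal.ofReal (Real.exp (2 * (a * (H * C / s)) * ((Finset.univ.filter fun i : Fin N =>
        ∃ t ∈ Icc (0 : ℝ) H, Φ.flow t z i ≠ localClusterState Ψ R t z i).card : ℝ))) ∂μ := by
  classical
  -- the bad count and its exponential
  set n : Config N (Fin 3) T3 → ℝ := fun z => ((Finset.univ.filter fun i : Fin N =>
    ∃ t ∈ Icc (0 : ℝ) H, Φ.flow t z i ≠ localClusterState Ψ R t z i).card : ℝ) with hndef
  set b : ℝ := a * (H * C / s) with hbdef
  set G : Config N (Fin 3) T3 → ENNReal := fun z => ENNReal.ofReal (Real.exp (b * n z)) with hGdef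
  have hGm : AEMeasurable G μ := aemeasurable_exp_badCount Φ Ψ R hH μ hgood b
  have hmap : Measure.map (Φ.flow s) μ = μ := (hinv s).map_eq
  have hGsm : AEMeasurable (fun z => G (Φ.flow s z)) μ := by
    have hG' : AEMeasurable G (Measure.map (Φ.flow s) μ) := by rwa [hmap]
    exact hG'.comp_measurable (Φ.measurable_flow s)
  -- pointwise: `a |D_E| ≤ b (#bad(Φ_s z) + #bad z)`
  have hpt : ∀ z, ENNReal.ofReal (Real.exp (a * |s⁻¹ * (E (Φ.flow s z) - E z)|)) ≤ G (Φ.flow s z) * G z := by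
    intro z
    have h := ForecastError.abs_errorQuotient_le Ψ Φ.flow R hH hf hs E hE z
    rw [hGdef]
    simp only
    rw [← ENNReal.ofReal_mul (Real.exp_pos _).le, ← Real.exp_add]
    refine ENNReal.ofReal_le_ofReal (Real.exp_le_exp.2 ?_)
    calc a * |s⁻¹ * (E (Φ.flow s z) - E z)| ≤ a * (H * C / s * (n (Φ.flow s z) + n z)) :=
          mul_le_mul_of_nonneg_left h ha
      _ = b * n (Φ.flow s z) + b * n z := by rw [hbdef]; ring
  -- Cauchy–Schwarz and invariance
  have hsq : ∀ z, G z ^ (2 : ℝ) = ENNReal.ofReal (Real.exp (2 * b * n z)) := by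
    intro z
    rw [hGdef]
    simp only
    rw [ENNReal.ofReal_rpow_of_nonneg (Real.exp_pos _).le (by norm_num), ← Real.exp_mul]
    congr 2
    ring
  have hinvG : ∫⁻ z, G (Φ.flow s z) ^ (2 : ℝ) ∂μ = ∫⁻ z, G z ^ (2 : ℝ) ∂μ := by
    have hG2 : AEMeasurable (fun z => G z ^ (2 : ℝ)) (Measure.map (Φ.flow s) μ) := by
      rw [hmap]; exact hGm.pow_const _
    rw [← lintegral_map' hG2 (Φ.measurable_flow s).aemeasurable, hmap]
  calc ∫⁻ z, ENNReal.ofReal (Real.exp (a * |s⁻¹ * (E (Φ.flow s z) - E z)|)) ∂μ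
      ≤ ∫⁻ z, G (Φ.flow s z) * G z ∂μ := lintegral_mono fun z => hpt z
    _ ≤ (∫⁻ z, G (Φ.flow s z) ^ (2 : ℝ) ∂μ) ^ (1 / (2 : ℝ)) * (∫⁻ z, G z ^ (2 : ℝ) ∂μ) ^ (1 / (2 : ℝ)) :=
        ENNReal.lintegral_mul_le_Lp_mul_Lq μ Real.HolderConjugate.two_two hGsm hGm
    _ = (∫⁻ z, G z ^ (2 : ℝ) ∂μ) ^ (1 / (2 : ℝ)) * (∫⁻ z, G z ^ (2 : ℝ) ∂μ) ^ (1 / (2 : ℝ)) := by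
        rw [hinvG]
    _ = ∫⁻ z, G z ^ (2 : ℝ) ∂μ := by
        rw [← ENNReal.rpow_add_of_nonneg _ _ (by norm_num) (by norm_num)]
        norm_num
    _ = ∫⁻ z, ENNReal.ofReal (Real.exp (2 * (a * (H * C / s)) * n z)) ∂μ := by
        refine lintegral_congr fun z => ?_
        rw [hsq, hbdef]

end ForecastError

end Summit.AtomisticToContinuum.HydrodynamicLimit.Theorems

end
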